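import Summits.CriticalPhenomena.Ising3DConformalLimit.Theses.LatticeSDPCertificates
import Summits.CriticalPhenomena.Ising3DConformalLimit.Theorems.LatticeSDPCertificatesCertifiedWindowOneStep
import Literature.Probability.LatticeModels.BoundaryLawFunctionalLevels
import HarnessLib

/-!
# Route `LatticeSDPCertificates`, crux `CertifiedWindow` (stmt-CriticalPhenomena-5504):
# the crux is ONE inequality per level — `κ E{0, R e₁} ≤ E{0, q R e₁}` at level `k R`

Sharpening of the one-scale-factor criterion `certifiedWindow_iff_oneStep`
(`…CertifiedWindowOneStep.lean`: CW ⇔ some `q ≥ 2`, `κ > q^{-3/2}`, `k ≥ q` make every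
row-feasible level-`kR` boundary-law functional satisfy `κ E{0,n e₁} ≤ E{0,q n e₁}` for ALL
`1 ≤ n ≤ R`). By the NESTING OF LEVELS of boundary-law functionals
(`boundaryLawFunctional_eq_of_le`: the level-`kR` functional of `ν` is the level-`kn` functional
of the resampled law `ν γ_{Λ_{kR}}`, `n ≤ R`; Friedli–Velenik 2017, Lemma 6.7) and the
monotonicity of the rows in the level (`LatticeBootstrapFeasible.of_le`), the inequality at the
TOP pair `(R, q R)` for all `(R, ν)` already gives it at every pair `(n, q n)`, `n ≤ R`:

* `oneStep_of_topPair`, `topPair_of_oneStep` — the two hypotheses are equivalent;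
* `certifiedWindow_iff_topPair` — **`CertifiedWindow` holds iff for all window constants there
  are `q ≥ 2`, `κ > q^{-3/2}`, `k ≥ q` such that for every `R ≥ 1` and every probability boundary
  law `ν` whose level-`kR` functional `E` is row-feasible, `κ E{0, R e₁} ≤ E{0, q R e₁}`** —
  one scalar inequality per `(R, ν)`: an `R`-uniform certificate of the route is exactly a dual
  certificate, at each level `kR`, for the single linear functional `E{0,qRe₁} - κ E{0,Re₁}`;
* `stub_topPairCriterion` — the registered stub of the crux skeleton (rev 3) discharged by name.

Helper file (`--supports stmt-CriticalPhenomena-5504`); nothing here proves or refutes the crux.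
References: Friedli–Velenik 2017, Lemma 6.7 [FriedliVelenik2017]; Cho–Sun 2023, Def. 12
[ChoSun2023] (rows); the reduction is elementary [folklore].
-/

noncomputable section

namespace Summit.CriticalPhenomena.Ising3DConformalLimit.Theorems

open Literature.Probability.LatticeModels MeasureTheory
open Summit.CriticalPhenomena.Ising3DConformalLimit.Theses.LatticeSDPCertificates

/-- **Top pair ⇒ every pair.** If the `q`-adic inequality holds at the top pair `(R, qR)` of
every row-feasible level-`kR` functional (all `R ≥ 1`, all probability boundary laws), then it
holds at every pair `(n, qn)`, `1 ≤ n ≤ R`: view the level-`kR` functional of `ν` as the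
level-`kn` functional of the resampled law `ν γ_{Λ_{kR}}` (`boundaryLawFunctional_eq_of_le`),
which is again a probability boundary law and row-feasible at level `kn`
(`LatticeBootstrapFeasible.of_le`), and apply the hypothesis at `(n, ν γ_{Λ_{kR}})`. [folklore] -/
theorem oneStep_of_topPair
    (h : ∀ cw Cw : ℝ, 0 < cw → 0 < Cw → ∃ (q : ℕ) (κ : ℝ) (k : ℕ), 2 ≤ q ∧
      (q : ℝ) ^ (-((3 : ℝ) / 2)) < κ ∧ q ≤ k ∧
      ∀ (R : ℕ) (ν : Measure (SpinConfig (Site 3))), IsProbabilityMeasure ν →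
        LatticeBootstrapFeasible (k * R) cw Cw
          (boundaryLawFunctional 3 (k * R) (criticalBeta 3) ν) → 1 ≤ R →
        κ * boundaryLawFunctional 3 (k * R) (criticalBeta 3) ν {0, Pi.single 0 (R : ℤ)} ≤
          boundaryLawFunctional 3 (k * R) (criticalBeta 3) ν {0, Pi.single 0 ((q * R : ℕ) : ℤ)}) :
    ∀ cw Cw : ℝ, 0 < cw → 0 < Cw → ∃ (q : ℕ) (κ : ℝ) (k : ℕ), 2 ≤ q ∧
      (q : ℝ) ^ (-((3 : ℝ) / 2)) < κ ∧ q ≤ k ∧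
      ∀ (R : ℕ) (ν : Measure (SpinConfig (Site 3))), IsProbabilityMeasure ν →
        LatticeBootstrapFeasible (k * R) cw Cw
          (boundaryLawFunctional 3 (k * R) (criticalBeta 3) ν) →
        ∀ n : ℕ, 1 ≤ n → n ≤ R →
          κ * boundaryLawFunctional 3 (k * R) (criticalBeta 3) ν {0, Pi.single 0 (n : ℤ)} ≤
            boundaryLawFunctional 3 (k * R) (criticalBeta 3) ν
              {0, Pi.single 0 ((q * n : ℕ) : ℤ)} := by
  intro cw Cw hcw hCw
  obtain ⟨q, κ, k, hq, hqκ, hqk, hR⟩ := h cw Cw hcw hCw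
  refine ⟨q, κ, k, hq, hqκ, hqk, fun R ν hν hfeas n hn hnR => ?_⟩
  have hkn : k * n ≤ k * R := Nat.mul_le_mul_left k hnR
  haveI : IsProbabilityMeasure
      (ν.bind (isingSpecification (zdGraph 3) (criticalBeta 3) 0 (box 3 (k * R)))) :=
    isProbabilityMeasure_bind_isingSpecification _ _ ν
  have hfun : boundaryLawFunctional 3 (k * n) (criticalBeta 3)
      (ν.bind (isingSpecification (zdGraph 3) (criticalBeta 3) 0 (box 3 (k * R)))) =
      boundaryLawFunctional 3 (k * R) (criticalBeta 3) ν := by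
    funext A
    exact (boundaryLawFunctional_eq_of_le hkn _ ν A).symm
  have hfeas' : LatticeBootstrapFeasible (k * n) cw Cw (boundaryLawFunctional 3 (k * n)
      (criticalBeta 3)
      (ν.bind (isingSpecification (zdGraph 3) (criticalBeta 3) 0 (box 3 (k * R))))) := by
    rw [hfun]
    exact hfeas.of_le hkn
  have key := hR n _ inferInstance hfeas' hn
  rw [hfun] at key
  exact key

/-- **Every pair ⇒ top pair** (specialise `n := R`). [folklore] -/
theorem topPair_of_oneStep
    (h : ∀ cw Cw : ℝ, 0 < cw → 0 < Cw → ∃ (q : ℕ) (κ : ℝ) (k : ℕ), 2 ≤ q ∧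
      (q : ℝ) ^ (-((3 : ℝ) / 2)) < κ ∧ q ≤ k ∧
      ∀ (R : ℕ) (ν : Measure (SpinConfig (Site 3))), IsProbabilityMeasure ν →
        LatticeBootstrapFeasible (k * R) cw Cw
          (boundaryLawFunctional 3 (k * R) (criticalBeta 3) ν) →
        ∀ n : ℕ, 1 ≤ n → n ≤ R →
          κ * boundaryLawFunctional 3 (k * R) (criticalBeta 3) ν {0, Pi.single 0 (n : ℤ)} ≤
            boundaryLawFunctional 3 (k * R) (criticalBeta 3) ν
              {0, Pi.single 0 ((q * n : ℕ) : ℤ)}) :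
    ∀ cw Cw : ℝ, 0 < cw → 0 < Cw → ∃ (q : ℕ) (κ : ℝ) (k : ℕ), 2 ≤ q ∧
      (q : ℝ) ^ (-((3 : ℝ) / 2)) < κ ∧ q ≤ k ∧
      ∀ (R : ℕ) (ν : Measure (SpinConfig (Site 3))), IsProbabilityMeasure ν →
        LatticeBootstrapFeasible (k * R) cw Cw
          (boundaryLawFunctional 3 (k * R) (criticalBeta 3) ν) → 1 ≤ R →
        κ * boundaryLawFunctional 3 (k * R) (criticalBeta 3) ν {0, Pi.single 0 (R : ℤ)} ≤
          boundaryLawFunctional 3 (k * R) (criticalBeta 3) ν {0, Pi.single 0 ((q * R : ℕ) : ℤ)} := by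
  intro cw Cw hcw hCw
  obtain ⟨q, κ, k, hq, hqκ, hqk, hR⟩ := h cw Cw hcw hCw
  exact ⟨q, κ, k, hq, hqκ, hqk, fun R ν hν hfeas hR1 => hR R ν hν hfeas R hR1 le_rfl⟩

/-- **`CertifiedWindow` ⇔ one inequality per level**: the crux holds iff for all window
constants there are `q ≥ 2`, `κ > q^{-3/2}`, `k ≥ q` such that every row-feasible level-`kR`
boundary-law functional (`R ≥ 1`, any probability boundary law) satisfies the single inequality
`κ E{0, R e₁} ≤ E{0, q R e₁}`. [folklore] -/
theorem certifiedWindow_iff_topPair :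
    CertifiedWindow ↔
      ∀ cw Cw : ℝ, 0 < cw → 0 < Cw → ∃ (q : ℕ) (κ : ℝ) (k : ℕ), 2 ≤ q ∧
      (q : ℝ) ^ (-((3 : ℝ) / 2)) < κ ∧ q ≤ k ∧
      ∀ (R : ℕ) (ν : Measure (SpinConfig (Site 3))), IsProbabilityMeasure ν →
        LatticeBootstrapFeasible (k * R) cw Cw
          (boundaryLawFunctional 3 (k * R) (criticalBeta 3) ν) → 1 ≤ R →
        κ * boundaryLawFunctional 3 (k * R) (criticalBeta 3) ν {0, Pi.single 0 (R : ℤ)} ≤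
          boundaryLawFunctional 3 (k * R) (criticalBeta 3) ν {0, Pi.single 0 ((q * R : ℕ) : ℤ)} :=
  certifiedWindow_iff_oneStep.trans ⟨topPair_of_oneStep, fun h => oneStep_of_topPair h⟩

/-! ### The registered stub of the crux skeleton -/

/-- **Registered stub `stub_topPairCriterion` of the rev-3 skeleton of crux `CertifiedWindow`
(line `registered` = `Cruxes/CertifiedWindow/Lines/birth.lean`)**, verbatim the registered
signature: the top-pair criterion implies the crux. [folklore] -/
theorem stub_topPairCriterion : (∀ cw Cw : ℝ, 0 < cw → 0 < Cw → ∃ (q : ℕ) (κ : ℝ) (k : ℕ), 2 ≤ q ∧ (q : ℝ) ^ (-((3 : ℝ) / 2)) < κ ∧ q ≤ k ∧ ∀ (R : ℕ) (ν : MeasureTheory.Measure (Literature.Probability.LatticeModels.SpinConfig (Literature.Probability.LatticeModels.Site 3))), MeasureTheory.IsProbabilityMeasure ν → Literature.Probability.LatticeModels.LatticeBootstrapFeasible (k * R) cw Cw (Literature.Probability.LatticeModels.boundaryLawFunctional 3 (k * R) (Literature.Probability.LatticeModels.criticalBeta 3) ν) → 1 ≤ R → κ * Literature.Probability.LatticeModels.boundaryLawFunctional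 3 (k * R) (Literature.Probability.LatticeModels.criticalBeta 3) ν {0, Pi.single 0 (R : ℤ)} ≤ Literature.Probability.LatticeModels.boundaryLawFunctional 3 (k * R) (Literature.Probability.LatticeModels.criticalBeta 3) ν {0, Pi.single 0 ((q * R : ℕ) : ℤ)}) → Summit.CriticalPhenomena.Ising3DConformalLimit.Theses.LatticeSDPCertificates.CertifiedWindow :=
  fun h => certifiedWindow_of_oneStep (oneStep_of_topPair h)

end Summit.CriticalPhenomena.Ising3DConformalLimit.Theorems
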